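import Summits.QuantumFields.YangMills.Theorems.PencilRigidityDiagonalMirrorRPRStubMirrorClusteringAxisZero

/-!
# Crux `DiagonalMirrorRPR` (stmt-QuantumFields-10604), line `kms-variance-lukewarm-descent`:
# the ORDERABLE case of `stub_mirrorClustering` (registered sub-goal `stub_mirrorClustering_orderable`)

Routes `PencilRigidity` / `MirrorModularBoosts` of `YangMills`, crux `DiagonalMirrorRPR`, registered skeleton
`Cruxes/DiagonalMirrorRPR/Lines/kms_variance_lukewarm_descent.lean` (namespace `…KmsVarianceLukewarmDescent`).  The
registered stub `stub_mirrorClustering : W₁ ⇒ MirrorClustering S₁` asks the mirror covariance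
`mirrorCov S₁ f μ d → 0` (`μ ∈ {0,1}`) for ALL compact real families with pairwise disjoint supports; the package `W₁`
speaks about it only through the `e₀`-based clauses E4/`HasMassGap`, E3, translations and proper signed permutations
on `⁰𝒮`, which give exactly the families supported in pairwise ORDERED closed `x_μ`-slabs.  This module proves that
orderable case (registered sub-goal `stub_mirrorClustering_orderable`); the residual (families with overlapping
`x_μ`-projections, the planners' (R0')) is conjecture-class and not addressed.

Content: §1 the proper signed permutation `Q = σ₀ ∘ swap₀₁` (`Q e₀ = e₁`, `Q e₁ = −e₀`, `Q e₂ = e₂`, `Q e₃ = e₃`,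
`det Q = 1`, `Q σ₀ = σ₁ Q`); §2 transport: the `e₁`-mirror data of `g ∘ Q⁻¹` are the `Q`-images of the `e₀`-mirror
data of `g`, so by the `W(B₄)`-clause `mirrorCov S₁ (g ∘ Q⁻¹) 1 d = mirrorCov S₁ g 0 d` for `d` large; then the stub,
from `tendsto_mirrorCov_axisZero` of the sibling module `…StubMirrorClusteringAxisZero` (`μ = 0` directly, `μ = 1`
with `g = f ∘ Q`).

References: K. Osterwalder, R. Schrader, Comm. Math. Phys. 31 (1973) §2–3; J. Glimm, A. Jaffe, *Quantum Physics*
§6.1; J. Fröhlich, R. Israel, E. Lieb, B. Simon, Comm. Math. Phys. 62 (1978) Thm 2.1 (the `(e₀, e₁)`-symmetry of the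
setting).
-/

set_option autoImplicit false

noncomputable section

open scoped SchwartzMap ComplexConjugate
open MeasureTheory Filter Topology
open Literature.MathematicalPhysics.QuantumLattice Literature.MathematicalPhysics.AQFT
  Literature.MathematicalPhysics.QuantumFieldTheory
open Summit.QuantumFields.YangMills.Cruxes.DiagonalMirrorRPR.ParityBridgeColdTraces
open Summit.QuantumFields.YangMills.Cruxes.DiagonalMirrorRPR.ParityBridgeColdTraces.RpClosure (signFlip ee
  signFlip_apply signFlip_single det_signFlip)

namespace Summit.QuantumFields.YangMills.Cruxes.DiagonalMirrorRPR.KmsVarianceLukewarmDescent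

namespace MirrorOrderable

/-! ## §1 The proper signed permutation `Q e₀ = e₁`, `Q e₁ = −e₀`, `Q e₂ = e₂`, `Q e₃ = e₃` -/

section Quarter

/-- The coordinate swap `x₀ ↔ x₁` as a linear isometry. -/
def swapIso : E4 ≃ₗᵢ[ℝ] E4 := LinearIsometryEquiv.piLpCongrLeft 2 ℝ ℝ (Equiv.swap (0 : Fin 4) 1)

/-- Coordinates of the swap. -/
theorem swapIso_apply (x : E4) (i : Fin 4) : swapIso x i = x (Equiv.swap (0 : Fin 4) 1 i) := by
  simp [swapIso, LinearIsometryEquiv.piLpCongrLeft_apply, Equiv.piCongrLeft'_apply, Equiv.symm_swap]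

/-- The swap on the standard basis. -/
theorem swapIso_ee (i : Fin 4) : swapIso (ee i) = ee (Equiv.swap (0 : Fin 4) 1 i) := by
  simp [swapIso, ee]

/-- The swap has determinant `−1`. -/
theorem det_swapIso : LinearMap.det ((swapIso).toLinearEquiv : E4 →ₗ[ℝ] E4) = -1 := by
  -- adapted from `det_signFlip` (…StubRpClosureDefs §I) and `det_funLeft_perm`
  -- (Literature/Barriers/CriticalPhenomena/WeaklySAWTranslationInvariance)
  classical
  rw [← LinearMap.det_toMatrix (PiLp.basisFun 2 ℝ (Fin 4))]
  have h : LinearMap.toMatrix (PiLp.basisFun 2 ℝ (Fin 4)) (PiLp.basisFun 2 ℝ (Fin 4))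
      ((swapIso).toLinearEquiv : E4 →ₗ[ℝ] E4) = (Equiv.swap (0 : Fin 4) 1).permMatrix ℝ := by
    ext i j
    rw [LinearMap.toMatrix_apply, PiLp.basisFun_repr, PiLp.basisFun_apply]
    simp only [LinearEquiv.coe_coe, LinearIsometryEquiv.coe_toLinearEquiv, Equiv.Perm.permMatrix,
      PEquiv.toMatrix_apply, Equiv.toPEquiv_apply, Option.mem_def, Option.some.injEq]
    rw [swapIso_apply, PiLp.single_apply]
  rw [h, Matrix.det_permutation, Equiv.Perm.sign_swap (by decide : (0 : Fin 4) ≠ 1)]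
  simp

/-- **The quarter turn** `Q = σ₀ ∘ swap₀₁`: `Q e₀ = e₁`, `Q e₁ = −e₀`, `Q e₂ = e₂`, `Q e₃ = e₃`. -/
def quarterTurn : E4 ≃ₗᵢ[ℝ] E4 := swapIso.trans (signFlip {0})

/-- The quarter turn on the standard basis: a signed permutation. -/
theorem quarterTurn_ee (i : Fin 4) :
    quarterTurn (ee i) =
      if Equiv.swap (0 : Fin 4) 1 i ∈ ({0} : Finset (Fin 4)) then -ee (Equiv.swap (0 : Fin 4) 1 i)
      else ee (Equiv.swap (0 : Fin 4) 1 i) := by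
  rw [quarterTurn, LinearIsometryEquiv.trans_apply, swapIso_ee, signFlip_single]

/-- `Q e₀ = e₁`. -/
theorem quarterTurn_ee_zero : quarterTurn (ee 0) = ee 1 := by
  rw [quarterTurn_ee]; simp

/-- The quarter turn is proper (`det Q = 1`). -/
theorem det_quarterTurn : LinearMap.det ((quarterTurn).toLinearEquiv : E4 →ₗ[ℝ] E4) = 1 := by
  have h : ((quarterTurn).toLinearEquiv : E4 →ₗ[ℝ] E4) =
      ((signFlip {0}).toLinearEquiv : E4 →ₗ[ℝ] E4).comp ((swapIso).toLinearEquiv : E4 →ₗ[ℝ] E4) := rfl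
  rw [h, LinearMap.det_comp, det_swapIso, det_signFlip]
  simp

/-- The quarter turn is a signed permutation. -/
theorem quarterTurn_signed (i : Fin 4) : ∃ j : Fin 4,
    quarterTurn (EuclideanSpace.single i 1) = EuclideanSpace.single j 1 ∨
      quarterTurn (EuclideanSpace.single i 1) = -EuclideanSpace.single j 1 := by
  refine ⟨Equiv.swap (0 : Fin 4) 1 i, ?_⟩
  have h := quarterTurn_ee i
  simp only [ee] at h
  rw [h]
  split_ifs <;> simp

/-- Coordinates of the quarter turn. -/
theorem quarterTurn_apply (x : E4) (i : Fin 4) :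
    quarterTurn x i = if i = 0 then -x 1 else x (Equiv.swap (0 : Fin 4) 1 i) := by
  rw [quarterTurn, LinearIsometryEquiv.trans_apply, signFlip_apply, swapIso_apply]
  by_cases hi : i = 0
  · subst hi; simp
  · simp [hi]

/-- `Q σ₀ = σ₁ Q`: the quarter turn conjugates the `e₀`-mirror into the `e₁`-mirror. -/
theorem quarterTurn_signFlip (y : E4) : quarterTurn (signFlip {0} y) = signFlip {1} (quarterTurn y) := by
  ext i
  rw [quarterTurn_apply, signFlip_apply, signFlip_apply, signFlip_apply, quarterTurn_apply]
  fin_cases i <;> simp [Equiv.swap_apply_def]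

/-- `(Q x)₁ = x₀`. -/
theorem quarterTurn_apply_one (x : E4) : quarterTurn x 1 = x 0 := by
  rw [quarterTurn_apply]; simp

end Quarter

/-! ## §2 Transport `e₁ ↦ e₀` by the quarter turn -/

section Transport

variable {n : ℕ} (S₁ : SchwingerFamily E4)

/-- The `e₁`-mirror copy of `g ∘ Q⁻¹` is `(e₀`-mirror copy of `g) ∘ Q⁻¹` (`Q σ₀ = σ₁ Q`, `Q e₀ = e₁`). -/
theorem mirrorFamily_one_quarterTurn (d : ℝ) (g : Fin n → 𝓢(E4, ℝ)) (i : Fin n) :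
    mirrorFamily 1 d (fun i => linActTest quarterTurn (g i)) i =
      linActTest quarterTurn (mirrorFamily 0 d g i) := by
  ext x
  simp only [mirrorFamily, translateTest_apply, linActTest_apply]
  congr 1
  rw [signFlip_symm_apply, signFlip_symm_apply]
  apply quarterTurn.injective
  rw [LinearIsometryEquiv.apply_symm_apply, quarterTurn_signFlip]
  congr 1
  rw [map_sub, map_smul, LinearIsometryEquiv.apply_symm_apply, quarterTurn_ee_zero]

/-- **Transport of the mirror covariance.**  By the `W(B₄)`-clause of `W₁` (the proper signed permutation `Q`) on
`⁰𝒮`, for `d` large `mirrorCov S₁ (g ∘ Q⁻¹) 1 d = mirrorCov S₁ g 0 d`: all three tensors of the left side are the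
`Q`-images of those of the right side, which are off-diagonal once the mirror slabs have left the original ones. -/
theorem mirrorCov_one_eventuallyEq
    (hrot : ∀ (R : E4 ≃ₗᵢ[ℝ] E4), LinearMap.det (R.toLinearEquiv : E4 →ₗ[ℝ] E4) = 1 →
      (∀ i : Fin 4, ∃ j : Fin 4, R (EuclideanSpace.single i 1) = EuclideanSpace.single j 1 ∨
        R (EuclideanSpace.single i 1) = -EuclideanSpace.single j 1) →
      ∀ (k : ℕ) (F : 𝓢((Fin k → E4), ℂ)), IsOffDiagonal F → S₁ k (linActMulti R F) = S₁ k F)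
    (g : Fin n → 𝓢(E4, ℝ)) (lo hi : Fin n → ℝ) (hord : ∀ i j, i < j → hi i < lo j)
    (hsupp : ∀ i, tsupport (g i : E4 → ℝ) ⊆ {x | lo i ≤ x 0 ∧ x 0 ≤ hi i}) :
    ∀ᶠ d in atTop, mirrorCov S₁ (fun i => linActTest quarterTurn (g i)) 1 d = mirrorCov S₁ g 0 d := by
  have hQ : ∀ (k : ℕ) (F : 𝓢((Fin k → E4), ℂ)), IsOffDiagonal F →
      S₁ k (linActMulti quarterTurn F) = S₁ k F :=
    hrot quarterTurn det_quarterTurn quarterTurn_signed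
  obtain ⟨M, hM⟩ := (Set.finite_range hi).bddAbove
  obtain ⟨s, hs⟩ : ∃ s : ℝ, ∀ i, hi i < s := ⟨M + 1, fun i => by linarith [hM ⟨i, rfl⟩]⟩
  filter_upwards [eventually_ge_atTop (2 * s)] with d hd
  -- the three `g`-tensors are off-diagonal
  obtain ⟨LO, HI, hsuppJ, hsepJ⟩ := joint_slabs g hord hsupp hs hd
  have hTJ : IsTensorOf (SchwartzMap.tensorFin (n + n) fun p => ofRealTest (Fin.append (mirrorFamily 0 d g) g p))
      fun p => ofRealTest (Fin.append (mirrorFamily 0 d g) g p) := isTensorOf_tensorFin _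
  have hJoff := isOffDiagonal_of_sep hTJ hsuppJ hsepJ
  have hTMd : IsTensorOf (SchwartzMap.tensorFin n fun i => ofRealTest (mirrorFamily 0 d g i))
      fun i => ofRealTest (mirrorFamily 0 d g i) := isTensorOf_tensorFin _
  have hMdoff :=
    isOffDiagonal_of_sep hTMd (fun i => tsupport_mirrorFamily_subset 0 d g hsupp i) (sep_mirror hord d)
  have hTP : IsTensorOf (SchwartzMap.tensorFin n fun i => ofRealTest (g i)) fun i => ofRealTest (g i) :=
    isTensorOf_tensorFin _
  have hPoff := isOffDiagonal_of_sep hTP hsupp (sep_of_ordered hord)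
  -- the three `g ∘ Q⁻¹`-tensors are the `Q`-images
  have hm : mirrorFamily 1 d (fun i => linActTest quarterTurn (g i)) =
      fun i => linActTest quarterTurn (mirrorFamily 0 d g i) :=
    funext fun i => mirrorFamily_one_quarterTurn d g i
  have hP' : (SchwartzMap.tensorFin n fun i => ofRealTest (linActTest quarterTurn (g i))) =
      linActMulti quarterTurn (SchwartzMap.tensorFin n fun i => ofRealTest (g i)) :=
    (isTensorOf_tensorFin _).unique (hTP.linActMulti quarterTurn)
  have hMd' :
      (SchwartzMap.tensorFin n fun i => ofRealTest (mirrorFamily 1 d (fun i => linActTest quarterTurn (g i)) i)) =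
        linActMulti quarterTurn (SchwartzMap.tensorFin n fun i => ofRealTest (mirrorFamily 0 d g i)) := by
    rw [hm]
    exact (isTensorOf_tensorFin _).unique (hTMd.linActMulti quarterTurn)
  have happ : (fun p => ofRealTest (Fin.append (mirrorFamily 1 d (fun i => linActTest quarterTurn (g i)))
      (fun i => linActTest quarterTurn (g i)) p)) =
      fun p => ofRealTest (linActTest quarterTurn (Fin.append (mirrorFamily 0 d g) g p)) := by
    funext p
    rw [hm]
    induction p using Fin.addCases with
    | left i => simp only [Fin.append_left]
    | right i => simp only [Fin.append_right]
  have hJ' : (SchwartzMap.tensorFin (n + n) fun p => ofRealTest (Fin.append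
      (mirrorFamily 1 d (fun i => linActTest quarterTurn (g i))) (fun i => linActTest quarterTurn (g i)) p)) =
      linActMulti quarterTurn
        (SchwartzMap.tensorFin (n + n) fun p => ofRealTest (Fin.append (mirrorFamily 0 d g) g p)) := by
    rw [happ]
    exact (isTensorOf_tensorFin _).unique (hTJ.linActMulti quarterTurn)
  unfold mirrorCov
  rw [hJ', hMd', hP', hQ _ _ hJoff, hQ _ _ hMdoff, hQ _ _ hPoff]

end Transport

end MirrorOrderable

open MirrorOrderable in
/-- **Registered sub-goal `stub_mirrorClustering_orderable` (the ORDERABLE case of `stub_mirrorClustering`).**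
For `μ ∈ {0, 1}` and a real family supported in pairwise ordered closed `x_μ`-slabs, the mirror covariance
`mirrorCov S₁ f μ d → 0` as `d → ∞`, from `W₁` alone: E4/`HasMassGap Δ` (`Δ > 0`) + E3 + translation invariance
on `⁰𝒮` for `μ = 0` (`tendsto_mirrorCov_axisZero`), transported to `μ = 1` by the proper signed permutation
`Q e₀ = e₁, Q e₁ = −e₀` of the `W(B₄)`-clause (`mirrorCov_one_eventuallyEq`).  The residual of
`stub_mirrorClustering` (families with overlapping `x_μ`-projections, (R0')) is not addressed here. -/
theorem stub_mirrorClustering_orderable :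
    ∀ (G : Type) [Group G] [TopologicalSpace G] [IsTopologicalGroup G] [CompactSpace G] [MeasurableSpace G]
      [BorelSpace G] (r : LatticeRep G) (sch : SpeciesScheme (YMSpecies G)) (S₁ : SchwingerFamily E4),
      CurvaturePackage r sch S₁ → ∀ μ : Fin 4, (μ = 0 ∨ μ = 1) → ∀ (n : ℕ), n ≠ 0 →
        ∀ (f : Fin n → 𝓢(E4, ℝ)) (lo hi : Fin n → ℝ), (∀ i j, i < j → hi i < lo j) →
          (∀ i, tsupport (f i : E4 → ℝ) ⊆ {x | lo i ≤ x μ ∧ x μ ≤ hi i}) →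
            Tendsto (fun d : ℝ => mirrorCov S₁ f μ d) atTop (𝓝 0) := by
  intro G _ _ _ _ _ _ r sch S₁ hW μ hμ n _hn f lo hi hord hsupp
  obtain ⟨-, ⟨-, -, -, -, hE3, -⟩, htr, hrot, Δ, hΔ, hgap, -⟩ := hW
  rcases hμ with rfl | rfl
  · exact tendsto_mirrorCov_axisZero S₁ htr hE3 hΔ hgap f lo hi hord hsupp
  · -- transport by the quarter turn: `f = (f ∘ Q) ∘ Q⁻¹` and `f ∘ Q` is slab-ordered along `e₀`
    have hsupp' : ∀ i, tsupport (linActTest quarterTurn.symm (f i) : E4 → ℝ) ⊆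
        {x | lo i ≤ x 0 ∧ x 0 ≤ hi i} := by
      intro i x hx
      have h1 := RpClosure.tsupport_linActTest_subset _ _ hx
      rw [Set.mem_preimage, LinearIsometryEquiv.symm_symm] at h1
      have h2 := hsupp i h1
      simp only [Set.mem_setOf_eq, quarterTurn_apply_one] at h2
      exact h2
    have hfg : f = fun i => linActTest quarterTurn (linActTest quarterTurn.symm (f i)) := by
      funext i
      ext x
      simp
    have hlim := tendsto_mirrorCov_axisZero S₁ htr hE3 hΔ hgap (fun i => linActTest quarterTurn.symm (f i))
      lo hi hord hsupp'
    have hev := mirrorCov_one_eventuallyEq S₁ hrot (fun i => linActTest quarterTurn.symm (f i)) lo hi hord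
      hsupp'
    rw [hfg]
    exact hlim.congr' (hev.mono fun d hd => hd.symm)

end Summit.QuantumFields.YangMills.Cruxes.DiagonalMirrorRPR.KmsVarianceLukewarmDescent

end
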